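import Mathlib
import Summits.NavierStokesRegularity.NavierStokesRegularity.Theorems.EulerZoomLiouvillePowerGaugeEulerLiouvilleSpiralProfileGradient
import Summits.NavierStokesRegularity.NavierStokesRegularity.Theorems.EulerZoomLiouvillePowerGaugeEulerLiouvilleSelfSimilarPastProfileDissipation
import HarnessLib

/-!
# Crux `EulerZoomLiouville.PowerGaugeEulerLiouville` (stmt-NavierStokesRegularity-19832), line `relative_equilibria` (ns-idea-11), R3a PORT RECIPE
# brick P3 (second half): THE `E`-GAUGE OF A SPIRAL MEMBER IN PROFILE VARIABLES — `∫_{B_L} |G|²_F ≤ C L^{1−ρ}` (large scales)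

Route №10 `EulerZoomLiouville` (NavierStokesRegularity), crux E; width seat ns-ezl-w1 g10 under the LEAD ns-typeII-p2 (R3a recipe, brick P3 =
spiral twin of `Past.profile_gradient_growth_of_gaugeE_past` / `Past.exists_profileGradient_growth_of_past`, …SelfSimilarPastProfileDissipation).

The delta w.r.t. the untwisted brick is one line: on each slice the weak gradient of the spiral member is the shifted self-similar gradient of the
ROTATED profile gradient `Q_λ ∘L G(Q_λ⁻¹ ·) ∘L Q_λ⁻¹` (brick `Spiral.exists_profileGradient_ae_of_pastSpiral`), whose Frobenius ball masses equal those
of `G` (`Twisted.sliceMass_conj`: the Frobenius norm is invariant under orthogonal conjugation and origin-centred balls are rotation invariant).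

* `Spiral.lintegral_ball_frobeniusNormSq_rotatedGradient_ge` — per slice: `s^{3γ−2} ∫_{B_L} |G|²_F ≤ ∫_{B_a} |s^{−1} R G(R⁻¹ s^{−γ}(x − x₀)) R⁻¹|²_F dx`
  for `s^{γ}L + ‖x₀‖ ≤ a`;
* ★ `Spiral.profile_gradient_growth_of_gaugeE_pastSpiral` — the `E`-gauge `a^{ρ}E(a;0;H) ≤ c` and the spiral identification of `H` give
  `∫_{B_L} |G|²_F ≤ C L^{1−ρ}` for `L ≥ 2 − T₁` (`C = S^{2−3γ}(S^{γ} + ‖x₀‖)^{1−ρ} c`, `S = T − T₁ + 2`, as untwisted);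
* ★ `Spiral.exists_profileGradient_growth_of_pastSpiral` — P3 at the member level: weak gradient on the slab + spiral ansatz (`IsPastSpiral`, `twist` written
  out) + `E`-gauge ⇒ a profile gradient `G` (weak derivative of `V`, a.e.-strongly measurable, identified with `H` on the past sub-slab through the rotation)
  with `∫_{B_L} |G|²_F ≤ C L^{1−ρ}` for `L ≥ 2 − T₁` — the (E₁) clause of `Sig.stub_spiralLocData` up to the `L ≥ 1` inflation of the assembly.

WHAT THIS IS NOT: not NS, not E, not a stub: one brick (P3) of the port R3a of a width sub-line; 19832 OPEN; no summit statement is proved by this file.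
[folklore; ChaeTsai2013DSS p. 4 (Perelman's rotated ansatz)]
-/

noncomputable section

-- flat `Theorems/<Route><Decl>…` files of one crux share the namespace of the crux (tree convention: `Summit.<S>.<S>.…`)
set_option linter.dupNamespace false

open MeasureTheory Set Filter Topology Metric Function TopologicalSpace
open scoped ENNReal NNReal RealInnerProductSpace

namespace Summit.NavierStokesRegularity.NavierStokesRegularity.Theorems.PowerGaugeEulerLiouville

open Literature.Analysis Literature.Analysis.FunctionSpaces Literature.Analysis.FluidPDE

namespace Spiral

variable {S : EuclideanSpace ℝ (Fin 3) →L[ℝ] EuclideanSpace ℝ (Fin 3)}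

/-! ### Per slice: the rotated shifted self-similar gradient on a large ball dominates the profile gradient on `B_L` -/

/-- **Ball integrals of `|H|²_F` for a ROTATED shifted self-similar gradient — the large-scale lower bound.**  For `s > 0`, a linear isometry `R`, a profile
gradient `G`, and radii with `s^{γ} L + ‖x₀‖ ≤ a`:  `s^{3γ−2} ∫_{B_L(0)} |G|²_F ≤ ∫_{B_a(0)} |s^{−1} (R ∘L G(R⁻¹ s^{−γ}(x − x₀)) ∘L R⁻¹)|²_F dx`
(untwisted lemma for the rotated gradient `R ∘L G(R⁻¹·) ∘L R⁻¹` + `Twisted.sliceMass_conj`). [folklore] -/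
theorem lintegral_ball_frobeniusNormSq_rotatedGradient_ge (γ : ℝ) {s : ℝ} (hs : 0 < s)
    (x₀ : EuclideanSpace ℝ (Fin 3)) (R : EuclideanSpace ℝ (Fin 3) ≃ₗᵢ[ℝ] EuclideanSpace ℝ (Fin 3))
    (G : EuclideanSpace ℝ (Fin 3) → EuclideanSpace ℝ (Fin 3) →L[ℝ] EuclideanSpace ℝ (Fin 3))
    {a L : ℝ} (hLa : s ^ γ * L + ‖x₀‖ ≤ a) :
    ENNReal.ofReal (s ^ (3 * γ - 2)) *
        ∫⁻ y in ball (0 : EuclideanSpace ℝ (Fin 3)) L, ENNReal.ofReal (frobeniusNormSq (G y)) ≤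
      ∫⁻ x in ball (0 : EuclideanSpace ℝ (Fin 3)) a,
        ENNReal.ofReal (frobeniusNormSq (s ^ (-1 : ℝ) •
          ((R : EuclideanSpace ℝ (Fin 3) →L[ℝ] EuclideanSpace ℝ (Fin 3)).comp
            ((G (R.symm (s ^ (-γ) • (x - x₀)))).comp (R.symm : EuclideanSpace ℝ (Fin 3) →L[ℝ] EuclideanSpace ℝ (Fin 3)))))) := by
  have h := Past.lintegral_ball_frobeniusNormSq_shiftedGradient_ge γ hs x₀
    (fun z => (R : EuclideanSpace ℝ (Fin 3) →L[ℝ] EuclideanSpace ℝ (Fin 3)).comp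
      ((G (R.symm z)).comp (R.symm : EuclideanSpace ℝ (Fin 3) →L[ℝ] EuclideanSpace ℝ (Fin 3)))) hLa
  rwa [Twisted.sliceMass_conj R G L] at h

/-! ### The brick: the `E`-gauge of a spiral member in profile variables, large scales -/

/-- ★ **THE `E`-GAUGE OF A SPIRAL MEMBER IN PROFILE VARIABLES (large scales).**  Let `H` be a.e.-strongly measurable on the slab `(−∞,0) × ℝ³` with
`H(τ) = λ^{−1} • (e^{(log λ)S} ∘L G(e^{−(log λ)S} λ^{−γ}(· − x₀)) ∘L e^{−(log λ)S})` a.e. on `ℝ³` for a.e. `τ < T₁` (`λ = T − τ`, `T₁ ≤ 0`, `T₁ ≤ T`,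
`γ = 1/(2+ρ)`, `0 < ρ < 1`, `S` skew: the output of `Spiral.exists_profileGradient_ae_of_pastSpiral`), and suppose `a^{ρ} E(a; 0; H) ≤ c` for all `a > 0`.
Then for some `C < ∞`: `∫_{B_L} |G|²_F ≤ C L^{1−ρ}` for every `L ≥ 2 − T₁`.  The untwisted proof verbatim (window `(T₁−2, T₁−1) × B_a ⊆ Q_a(0,0)`,
Tonelli, slice lower bound, `C = S^{2−3γ}(S^{γ}+‖x₀‖)^{1−ρ} c`), the slice lower bound now for the rotated gradient. [folklore] -/
theorem profile_gradient_growth_of_gaugeE_pastSpiral {ρ : ℝ} (hρ : 0 < ρ) (hρ1 : ρ < 1)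
    {T T₁ : ℝ} (hT₁ : T₁ ≤ 0) (hTT₁ : T₁ ≤ T) (x₀ : EuclideanSpace ℝ (Fin 3))
    (hS : ∀ x y : EuclideanSpace ℝ (Fin 3), ⟪S x, y⟫ = -⟪x, S y⟫)
    {H : ℝ → EuclideanSpace ℝ (Fin 3) → EuclideanSpace ℝ (Fin 3) →L[ℝ] EuclideanSpace ℝ (Fin 3)}
    {G : EuclideanSpace ℝ (Fin 3) → EuclideanSpace ℝ (Fin 3) →L[ℝ] EuclideanSpace ℝ (Fin 3)} {c : ℝ≥0}
    (hHm : AEStronglyMeasurable (uncurry H)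
      (volume.restrict (Iio (0 : ℝ) ×ˢ (univ : Set (EuclideanSpace ℝ (Fin 3))))))
    (hH : ∀ᵐ τ ∂((volume : Measure ℝ).restrict (Iio T₁)),
      H τ =ᵐ[volume] fun x => (T - τ) ^ (-1 : ℝ) •
        ((NormedSpace.exp ((Real.log (T - τ)) • S)).comp
          ((G (NormedSpace.exp ((-Real.log (T - τ)) • S) ((T - τ) ^ (-(1 / (2 + ρ))) • (x - x₀)))).comp
            (NormedSpace.exp ((-Real.log (T - τ)) • S)))))
    (hE : ∀ a : ℝ, 0 < a →
      ENNReal.ofReal (a ^ ρ) * cknE a (0 : ℝ × EuclideanSpace ℝ (Fin 3)) H ≤ (c : ℝ≥0∞)) :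
    ∃ C : ℝ≥0∞, C ≠ ⊤ ∧ ∀ L : ℝ, 2 - T₁ ≤ L →
      ∫⁻ y in ball (0 : EuclideanSpace ℝ (Fin 3)) L, ENNReal.ofReal (frobeniusNormSq (G y)) ≤
        C * ENNReal.ofReal (L ^ (1 - ρ)) := by
  -- adapted VERBATIM from `Past.profile_gradient_growth_of_gaugeE_past` (ns-ezl-w1, …SelfSimilarPastProfileDissipation); only step (4) changes
  set γ : ℝ := 1 / (2 + ρ) with hγ
  have h2ρ : 0 < 2 + ρ := by linarith
  have hγ0 : 0 < γ := by rw [hγ]; positivity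
  have hγ23 : 3 * γ - 2 ≤ 0 := by
    have : γ ≤ 1 / 2 := by
      rw [hγ, div_le_div_iff₀ h2ρ two_pos]; linarith
    linarith
  have h1ρ : 0 ≤ 1 - ρ := by linarith
  have hfm : Measurable fun L : EuclideanSpace ℝ (Fin 3) →L[ℝ] EuclideanSpace ℝ (Fin 3) =>
      ENNReal.ofReal (frobeniusNormSq L) :=
    (SereginZajaczkowski2007.continuous_frobeniusNormSq).measurable.ennreal_ofReal
  -- the time scale `S' = T − T₁ + 2` of the window `(T₁ − 2, T₁ − 1)` and the constant
  set S' : ℝ := T - T₁ + 2 with hS'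
  have hS2 : 2 ≤ S' := by rw [hS']; linarith
  have hS0 : 0 < S' := by linarith
  set σ : ℝ := S' ^ γ with hσ
  have hσ0 : 0 < σ := Real.rpow_pos_of_pos hS0 _
  have hσ1 : 1 ≤ σ := Real.one_le_rpow (by linarith) hγ0.le
  set k : ℝ := S' ^ (2 - 3 * γ) * (σ + ‖x₀‖) ^ (1 - ρ) with hk
  refine ⟨ENNReal.ofReal k * (c : ℝ≥0∞), ENNReal.mul_ne_top ENNReal.ofReal_ne_top ENNReal.coe_ne_top,
    fun L hL => ?_⟩
  have hL2 : 2 ≤ L := by linarith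
  have hL0 : 0 < L := by linarith
  -- ### the radius `a = σ L + ‖x₀‖`
  set a : ℝ := σ * L + ‖x₀‖ with ha
  have haL : L ≤ a := by
    have : 1 * L ≤ σ * L := mul_le_mul_of_nonneg_right hσ1 hL0.le
    have := norm_nonneg x₀
    rw [ha]; linarith
  have ha0 : 0 < a := by linarith
  have ha2 : 2 - T₁ ≤ a ^ 2 := by nlinarith
  -- ### (1) the gauge: `X = ∫∫_{Q_a} |H|²_F ≤ a^{1−ρ} c`
  set X : ℝ≥0∞ := ∫⁻ q in parabolicCylinder a (0 : ℝ × EuclideanSpace ℝ (Fin 3)),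
    ENNReal.ofReal (frobeniusNormSq (H q.1 q.2)) with hX
  have hXle : X ≤ ENNReal.ofReal (a ^ (1 - ρ)) * (c : ℝ≥0∞) := by
    have h1 := hE a ha0
    unfold cknE at h1
    have hB0 : ENNReal.ofReal (a ^ ρ) ≠ 0 := by
      rw [ENNReal.ofReal_ne_zero_iff]; exact Real.rpow_pos_of_pos ha0 _
    have hA0 : ENNReal.ofReal a ≠ 0 := by rw [ENNReal.ofReal_ne_zero_iff]; exact ha0
    have key : X = ENNReal.ofReal a * (ENNReal.ofReal (a ^ ρ))⁻¹ *
        (ENNReal.ofReal (a ^ ρ) * ((ENNReal.ofReal a)⁻¹ * X)) := by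
      rw [← mul_assoc, mul_assoc (ENNReal.ofReal a), ENNReal.inv_mul_cancel hB0 ENNReal.ofReal_ne_top,
        mul_one, ← mul_assoc, ENNReal.mul_inv_cancel hA0 ENNReal.ofReal_ne_top, one_mul]
    calc X = _ := key
      _ ≤ ENNReal.ofReal a * (ENNReal.ofReal (a ^ ρ))⁻¹ * (c : ℝ≥0∞) := by gcongr
      _ = ENNReal.ofReal (a ^ (1 - ρ)) * (c : ℝ≥0∞) := by
          rw [← ENNReal.ofReal_inv_of_pos (Real.rpow_pos_of_pos ha0 _), ← ENNReal.ofReal_mul ha0.le]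
          congr 2
          rw [Real.rpow_sub ha0, Real.rpow_one, div_eq_mul_inv]
  -- ### (2) the window `(T₁ − 2, T₁ − 1) × B_a` inside `Q_a(0,0)`
  have hWsub : Ioo (T₁ - 2) (T₁ - 1) ×ˢ ball (0 : EuclideanSpace ℝ (Fin 3)) a ⊆
      parabolicCylinder a (0 : ℝ × EuclideanSpace ℝ (Fin 3)) := by
    intro q hq
    rw [mem_prod, mem_Ioo, mem_ball] at hq
    rw [mem_parabolicCylinder, Prod.fst_zero, Prod.snd_zero, zero_sub]
    exact ⟨⟨by linarith [hq.1.1], by linarith [hq.1.2]⟩, hq.2⟩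
  have hY : ∫⁻ q in Ioo (T₁ - 2) (T₁ - 1) ×ˢ ball (0 : EuclideanSpace ℝ (Fin 3)) a,
      ENNReal.ofReal (frobeniusNormSq (H q.1 q.2)) ≤ X :=
    lintegral_mono_set hWsub
  -- ### (3) Tonelli on the window
  have hHmW : AEMeasurable (fun q : ℝ × EuclideanSpace ℝ (Fin 3) =>
      ENNReal.ofReal (frobeniusNormSq (H q.1 q.2)))
      (((volume : Measure ℝ).restrict (Ioo (T₁ - 2) (T₁ - 1))).prod
        ((volume : Measure (EuclideanSpace ℝ (Fin 3))).restrict (ball 0 a))) := by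
    have hsub : Ioo (T₁ - 2) (T₁ - 1) ×ˢ ball (0 : EuclideanSpace ℝ (Fin 3)) a ⊆
        Iio (0 : ℝ) ×ˢ (univ : Set (EuclideanSpace ℝ (Fin 3))) :=
      prod_mono (fun t ht => by have := ht.2; rw [mem_Iio]; linarith) (subset_univ _)
    have := hfm.comp_aemeasurable (hHm.mono_measure (Measure.restrict_mono hsub le_rfl)).aemeasurable
    rwa [Measure.volume_eq_prod, ← Measure.prod_restrict] at this
  have hYeq : ∫⁻ q in Ioo (T₁ - 2) (T₁ - 1) ×ˢ ball (0 : EuclideanSpace ℝ (Fin 3)) a,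
        ENNReal.ofReal (frobeniusNormSq (H q.1 q.2)) =
      ∫⁻ τ in Ioo (T₁ - 2) (T₁ - 1), ∫⁻ x in ball (0 : EuclideanSpace ℝ (Fin 3)) a,
        ENNReal.ofReal (frobeniusNormSq (H τ x)) := by
    rw [Measure.volume_eq_prod, ← Measure.prod_restrict, lintegral_prod _ hHmW]
  -- ### (4) the a.e. lower bound on the slices of the window — the ROTATED slice lemma
  set J : ℝ≥0∞ := ∫⁻ y in ball (0 : EuclideanSpace ℝ (Fin 3)) L, ENNReal.ofReal (frobeniusNormSq (G y)) with hJ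
  have hWT : Ioo (T₁ - 2) (T₁ - 1) ⊆ Iio T₁ := fun t ht => by have := ht.2; rw [mem_Iio]; linarith
  have hlow : ∀ᵐ τ ∂((volume : Measure ℝ).restrict (Ioo (T₁ - 2) (T₁ - 1))),
      ENNReal.ofReal (S' ^ (3 * γ - 2)) * J ≤
        ∫⁻ x in ball (0 : EuclideanSpace ℝ (Fin 3)) a, ENNReal.ofReal (frobeniusNormSq (H τ x)) := by
    filter_upwards [ae_restrict_of_ae_restrict_of_subset hWT hH, ae_restrict_mem measurableSet_Ioo]
      with τ hτ hτW
    have hs : 0 < T - τ := by have := hτW.2; linarith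
    have hsS : T - τ ≤ S' := by have := hτW.1; rw [hS']; linarith
    obtain ⟨R, hR, hRs⟩ := exists_rot hS (Real.log (T - τ))
    -- replace `H τ` by the rotated self-similar gradient on the ball
    have hcongr : ∫⁻ x in ball (0 : EuclideanSpace ℝ (Fin 3)) a, ENNReal.ofReal (frobeniusNormSq (H τ x)) =
        ∫⁻ x in ball (0 : EuclideanSpace ℝ (Fin 3)) a, ENNReal.ofReal (frobeniusNormSq
          ((T - τ) ^ (-1 : ℝ) • ((R : EuclideanSpace ℝ (Fin 3) →L[ℝ] EuclideanSpace ℝ (Fin 3)).comp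
            ((G (R.symm ((T - τ) ^ (-γ) • (x - x₀)))).comp (R.symm : EuclideanSpace ℝ (Fin 3) →L[ℝ] EuclideanSpace ℝ (Fin 3)))))) := by
      refine lintegral_congr_ae (ae_restrict_of_ae (hτ.mono fun x hx => ?_))
      dsimp only
      rw [hx, coe_rot_eq hR, coe_rot_eq hRs, hRs]
    rw [hcongr]
    have hLa : (T - τ) ^ γ * L + ‖x₀‖ ≤ a := by
      have : (T - τ) ^ γ ≤ σ := Real.rpow_le_rpow hs.le hsS hγ0.le
      rw [ha]; nlinarith
    calc ENNReal.ofReal (S' ^ (3 * γ - 2)) * J ≤ ENNReal.ofReal ((T - τ) ^ (3 * γ - 2)) * J :=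
          mul_le_mul' (ENNReal.ofReal_le_ofReal (Real.rpow_le_rpow_of_nonpos hs hsS hγ23)) le_rfl
      _ ≤ _ := lintegral_ball_frobeniusNormSq_rotatedGradient_ge γ hs x₀ R G hLa
  -- ### (5) integrate the lower bound over the window (length `1`)
  have hvolW : volume (Ioo (T₁ - 2) (T₁ - 1)) = 1 := by
    rw [Real.volume_Ioo, show T₁ - 1 - (T₁ - 2) = (1 : ℝ) by ring, ENNReal.ofReal_one]
  have hJle : ENNReal.ofReal (S' ^ (3 * γ - 2)) * J ≤ X :=
    calc ENNReal.ofReal (S' ^ (3 * γ - 2)) * J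
        = ∫⁻ _ in Ioo (T₁ - 2) (T₁ - 1), ENNReal.ofReal (S' ^ (3 * γ - 2)) * J := by
          rw [setLIntegral_const, hvolW, mul_one]
      _ ≤ ∫⁻ τ in Ioo (T₁ - 2) (T₁ - 1), ∫⁻ x in ball (0 : EuclideanSpace ℝ (Fin 3)) a,
            ENNReal.ofReal (frobeniusNormSq (H τ x)) := lintegral_mono_ae hlow
      _ = _ := hYeq.symm
      _ ≤ X := hY
  -- ### (6) assemble
  have haL' : a ^ (1 - ρ) ≤ (σ + ‖x₀‖) ^ (1 - ρ) * L ^ (1 - ρ) := by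
    rw [← Real.mul_rpow (by positivity) hL0.le]
    refine Real.rpow_le_rpow ha0.le ?_ h1ρ
    have : ‖x₀‖ ≤ ‖x₀‖ * L := le_mul_of_one_le_right (norm_nonneg _) (by linarith)
    rw [ha]; nlinarith
  have hunit : ENNReal.ofReal (S' ^ (2 - 3 * γ)) * ENNReal.ofReal (S' ^ (3 * γ - 2)) = 1 := by
    rw [← ENNReal.ofReal_mul (Real.rpow_nonneg hS0.le _), ← Real.rpow_add hS0,
      show (2 - 3 * γ) + (3 * γ - 2) = 0 by ring, Real.rpow_zero, ENNReal.ofReal_one]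
  calc J = ENNReal.ofReal (S' ^ (2 - 3 * γ)) * (ENNReal.ofReal (S' ^ (3 * γ - 2)) * J) := by
        rw [← mul_assoc, hunit, one_mul]
    _ ≤ ENNReal.ofReal (S' ^ (2 - 3 * γ)) * X := by gcongr
    _ ≤ ENNReal.ofReal (S' ^ (2 - 3 * γ)) * (ENNReal.ofReal (a ^ (1 - ρ)) * (c : ℝ≥0∞)) := by gcongr
    _ ≤ ENNReal.ofReal (S' ^ (2 - 3 * γ)) *
          (ENNReal.ofReal ((σ + ‖x₀‖) ^ (1 - ρ) * L ^ (1 - ρ)) * (c : ℝ≥0∞)) := by gcongr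
    _ = ENNReal.ofReal k * (c : ℝ≥0∞) * ENNReal.ofReal (L ^ (1 - ρ)) := by
        rw [hk, ENNReal.ofReal_mul (by positivity), ENNReal.ofReal_mul (by positivity)]
        ring

/-! ### P3 at the member level -/

/-- ★ **P3 OF THE R3a RECIPE: PROFILE GRADIENT WITH LARGE-SCALE DISSIPATION GROWTH, FOR A SPIRAL MEMBER.**  Let `H` be a weak spatial gradient of `u`
on the slab `(−∞,0) × ℝ³`, `u(τ, x) = λ^{γ−1} e^{(log λ)S} V(e^{−(log λ)S} λ^{−γ}(x − x₀))` for `τ < T₁` (`λ = T − τ`; `T₁ ≤ 0`, `T₁ ≤ T`; `γ = 1/(2+ρ)`,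
`0 < ρ < 1`; `S` skew — the line's `IsPastSpiral ρ T T₁ x₀ S u V` with `twist` written out), and `a^{ρ} E(a; 0; H) ≤ c` for all `a > 0`.  Then there is a
profile gradient `G` — a.e.-strongly measurable, a weak derivative of `V` on `ℝ³`, with `H(τ) = λ^{−1} • (e^{(log λ)S} ∘L G(e^{−(log λ)S} λ^{−γ}(· − x₀)) ∘L e^{−(log λ)S})`
a.e. for a.e. `τ < T₁` — and `C < ∞` with `∫_{B_L} |G|²_F ≤ C L^{1−ρ}` for every `L ≥ 2 − T₁`. [folklore; ChaeTsai2013DSS p. 4] -/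
theorem exists_profileGradient_growth_of_pastSpiral {ρ : ℝ} (hρ : 0 < ρ) (hρ1 : ρ < 1)
    {T T₁ : ℝ} (hT₁ : T₁ ≤ 0) (hTT₁ : T₁ ≤ T) (x₀ : EuclideanSpace ℝ (Fin 3))
    (hS : ∀ x y : EuclideanSpace ℝ (Fin 3), ⟪S x, y⟫ = -⟪x, S y⟫)
    {u : ℝ → EuclideanSpace ℝ (Fin 3) → EuclideanSpace ℝ (Fin 3)}
    {H : ℝ → EuclideanSpace ℝ (Fin 3) → EuclideanSpace ℝ (Fin 3) →L[ℝ] EuclideanSpace ℝ (Fin 3)} {c : ℝ≥0}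
    (hH : HasWeakSpatialGradientOn (slab (EuclideanSpace ℝ (Fin 3)) (Iio 0) isOpen_Iio) u H)
    {V : EuclideanSpace ℝ (Fin 3) → EuclideanSpace ℝ (Fin 3)}
    (hu : ∀ τ : ℝ, τ < T₁ → u τ = fun x => (T - τ) ^ (1 / (2 + ρ) - 1) •
      NormedSpace.exp ((Real.log (T - τ)) • S) (V (NormedSpace.exp ((-Real.log (T - τ)) • S) ((T - τ) ^ (-(1 / (2 + ρ))) • (x - x₀)))))
    (hE : ∀ a : ℝ, 0 < a →
      ENNReal.ofReal (a ^ ρ) * cknE a (0 : ℝ × EuclideanSpace ℝ (Fin 3)) H ≤ (c : ℝ≥0∞)) :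
    ∃ G : EuclideanSpace ℝ (Fin 3) → EuclideanSpace ℝ (Fin 3) →L[ℝ] EuclideanSpace ℝ (Fin 3),
      AEStronglyMeasurable G volume ∧
      HasWeakFDerivOn (⊤ : Opens (EuclideanSpace ℝ (Fin 3))) volume V G ∧
      (∀ᵐ τ ∂((volume : Measure ℝ).restrict (Iio T₁)),
        H τ =ᵐ[volume] fun x => (T - τ) ^ (-1 : ℝ) •
          ((NormedSpace.exp ((Real.log (T - τ)) • S)).comp
            ((G (NormedSpace.exp ((-Real.log (T - τ)) • S) ((T - τ) ^ (-(1 / (2 + ρ))) • (x - x₀)))).comp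
              (NormedSpace.exp ((-Real.log (T - τ)) • S))))) ∧
      ∃ C : ℝ≥0∞, C ≠ ⊤ ∧ ∀ L : ℝ, 2 - T₁ ≤ L →
        ∫⁻ y in ball (0 : EuclideanSpace ℝ (Fin 3)) L, ENNReal.ofReal (frobeniusNormSq (G y)) ≤
          C * ENNReal.ofReal (L ^ (1 - ρ)) := by
  obtain ⟨G, hGm, hVG, hae⟩ := exists_profileGradient_ae_of_pastSpiral (γ := 1 / (2 + ρ)) hH hT₁ hTT₁ x₀ hS hu
  have hHm : AEStronglyMeasurable (uncurry H)
      (volume.restrict (Iio (0 : ℝ) ×ˢ (univ : Set (EuclideanSpace ℝ (Fin 3))))) := by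
    have := hH.locallyIntegrableOn_grad.aestronglyMeasurable
    simpa [slab] using this
  exact ⟨G, hGm, hVG, hae, profile_gradient_growth_of_gaugeE_pastSpiral hρ hρ1 hT₁ hTT₁ x₀ hS hHm hae hE⟩

end Spiral

end Summit.NavierStokesRegularity.NavierStokesRegularity.Theorems.PowerGaugeEulerLiouville

end
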